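import Mathlib.MeasureTheory.Integral.IntervalIntegral.Basic
import Literature.MathematicalPhysics.KineticTheory.InfiniteChainAmplitudeScaling
import Literature.MathematicalPhysics.KineticTheory.InfiniteChainSuperstableDynamics
import HarnessLib

/-!
# Amplitude scaling of the Buttà–Marchioro class, and the weak-anharmonicity (unit-temperature)
# form of the two kinetic children of `EmbeddedDrudeMourre.DrudeDissolution`

Helper file for crux `stmt-AtomisticToContinuum-12593` (`DrudeDissolution`), line `Sketch` rev 12
(lead c15, 2026-08-17), `--supports` only: nothing here closes an item.

The registered skeleton of the crux (`Cruxes/DrudeDissolution/Lines/Sketch.lean`, rev 12) is complete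
modulo its two stubs PKT∃ `stub_bmPostKineticTail` and KL∃ `stub_bmKineticLimit`, which are byte-for-byte
the strategist-certified split children `BmPostKineticTail` / `BmKineticLimit`
(`Cruxes/DrudeDissolution/SPLIT-READY.md`). Both quantify over pairs `(μ, D)` in the BUTTÀ–MARCHIORO
CLASS: `μ` a DLR state at temperature `T` invariant under the unit shift, `D` an infinite-volume
dynamics with `D.carrier = bmGood` preserving `μ` (by the landed rigidity `LineSketch.stub_bmRigidity`
such a pair has THE summed current autocorrelation `C_T` of the chain).

`InfiniteChainAmplitudeScaling.lean` conjugates `pinnedChain ω₂ (lam s²) (β s²) γ` at `T` with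
`pinnedChain ω₂ lam β γ` at `s² T` under `σ ↦ s • σ` (DLR states, dynamics, `C = s⁴ C'`); missing for the
CHILDREN was the behaviour of the two extra clauses of the BM class (carrier `bmGood`, shift invariance):

* §1 `bmLocalEnergy_smul`: `W^{lam,β}_{μ,k}(s • σ) = s² W^{lam s²,β s²}_{μ,k}(σ) + (1 − s²)(2k+1)`
  (BM's local energy (2.4) carries `+1` per site, hence the affine term); `bmGrowthSet_smul`;
  `smul_mem_bmGood_iff` and `image_smul_bmGood`: **the BM good set is dilation-covariant**,
  `S_s(bmGood^{lam s²,β s²}) = bmGood^{lam,β}`; `smulDynamics_carrier_eq_bmGood_iff`.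
* §2 `measurePreserving_shift_map_dil`: shift-invariance of the state transports.
* §3 `bmWitness_transport`: a BM-class pair of the rescaled chain at `T` whose `C'` satisfies `Φ`
  transports to a BM-class pair of the original chain at `s²T` whose `C` satisfies `Ψ`, for any
  predicates with `Φ C' → Ψ (s⁴ C')`.
* §4 THE UNIT-TEMPERATURE FORMS (pointwise in `T > 0`, then for the closed children statements with
  the parameters fixed): `exists_bmTailWitness_iff_unit_temp`, `bmPostKineticTail_iff_unit_temp` —
  child 1 at `(lam, β)` is EXACTLY: for every `e > 0` there are `M, ε₀ > 0` such that for all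
  `ε ∈ (0, ε₀)` the unit-temperature chain `pinnedChain ω₂ (lam ε) (β ε) γ` has a BM-class pair with
  `C ∈ L¹(M ε⁻², ∞)` and `ε² ∫_{M ε⁻²}^∞ |C| ≤ e` (kinetic clock `ε⁻²`, amplitude `ε²` — the form in which
  equilibrium MD and kinetic theory are parametrised, ALS06 (2.13)); `exists_bmWindowWitness_iff_unit_temp`,
  `bmKineticLimit_iff_unit_temp` — child 2 likewise with `|ε² ∫_{δε⁻²}^{Mε⁻²} C − ∫_δ^M K| ≤ e`.

Tree vocabulary only (`pinnedChain`, `bmGood`, `InfiniteChainDynamics`, `currentCorrelation`, `dilEquiv`, `smulDynamics`).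
-/

noncomputable section

open MeasureTheory Filter Set Topology
open scoped ENNReal
open Literature.MathematicalPhysics.KineticTheory.HeatConduction
open Literature.MathematicalPhysics.KineticTheory.HeatConduction.AmplitudeScaling

namespace Summit.AtomisticToContinuum.FouriersLaw.Theorems.DrudeDissolution.ChildrenScaling

variable (ω₂ lam β γ : ℝ)

/-! ## §1 The Buttà–Marchioro good set under the amplitude dilation -/

/-- The box `Λ_{μ,k} = {μ-k, …, μ+k}` has `2k+1` sites. [folklore] -/
theorem card_Icc_box (μ : ℤ) (k : ℕ) :
    ((Finset.Icc (μ - k) (μ + k)).card : ℝ) = 2 * k + 1 := by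
  have h : (Finset.Icc (μ - (k : ℤ)) (μ + k)).card = 2 * k + 1 := by
    rw [Int.card_Icc]
    have h' : μ + ↑k + 1 - (μ - ↑k) = ((2 * k + 1 : ℕ) : ℤ) := by push_cast; ring
    rw [h', Int.toNat_natCast]
  rw [h]; push_cast; ring

/-- **LOCAL ENERGY SCALING.** BM's local energy (2.4) of `pinnedChain ω₂ lam β γ` at `s • σ` is
`s²` times that of the rescaled chain `pinnedChain ω₂ (lam s²) (β s²) γ` at `σ`, up to the affine
term coming from the `+1` per site: `W_{μ,k}(s • σ) = s² W'_{μ,k}(σ) + (1 − s²) |Λ_{μ,k}|`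
(`½(sp)² = s² ½p²`, `U_{lam}(sq) = s² U_{lam s²}(q)`, `V_β(s r) = s² V_{β s²}(r)`).
[cite: ButtaMarchioro2016, §2 eq. (2.4)] -/
theorem bmLocalEnergy_smul (s : ℝ) (μ : ℤ) (k : ℕ) (σ : ChainConfig) :
    (pinnedChain ω₂ lam β γ).bmLocalEnergy μ k (s • σ) =
      s ^ 2 * (pinnedChain ω₂ (lam * s ^ 2) (β * s ^ 2) γ).bmLocalEnergy μ k σ +
        (1 - s ^ 2) * ((Finset.Icc (μ - k) (μ + k)).card : ℝ) := by
  set I : Finset ℤ := Finset.Icc (μ - k) (μ + k) with hI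
  have hsite : ∑ i ∈ I, (((s • σ) i).2 ^ 2 / 2 + (pinnedChain ω₂ lam β γ).U ((s • σ) i).1 + 1) =
      s ^ 2 * ∑ i ∈ I, ((σ i).2 ^ 2 / 2 +
        (pinnedChain ω₂ (lam * s ^ 2) (β * s ^ 2) γ).U (σ i).1 + 1) + (1 - s ^ 2) * (I.card : ℝ) := by
    have hterm : ∀ i ∈ I, ((s • σ) i).2 ^ 2 / 2 + (pinnedChain ω₂ lam β γ).U ((s • σ) i).1 + 1 =
        s ^ 2 * ((σ i).2 ^ 2 / 2 + (pinnedChain ω₂ (lam * s ^ 2) (β * s ^ 2) γ).U (σ i).1 + 1) +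
          (1 - s ^ 2) := by
      intro i _
      simp only [pinnedChain, Pi.smul_apply, Prod.smul_fst, Prod.smul_snd, smul_eq_mul]
      ring
    rw [Finset.sum_congr rfl hterm, Finset.sum_add_distrib, Finset.sum_const, nsmul_eq_mul,
      ← Finset.mul_sum]
    ring
  have hpair : ∑ i ∈ I, ∑ j ∈ I,
      (if |j - i| = 1 then (pinnedChain ω₂ lam β γ).V (((s • σ) i).1 - ((s • σ) j).1) else 0) =
      s ^ 2 * ∑ i ∈ I, ∑ j ∈ I, (if |j - i| = 1 then
        (pinnedChain ω₂ (lam * s ^ 2) (β * s ^ 2) γ).V ((σ i).1 - (σ j).1) else 0) := by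
    rw [Finset.mul_sum]
    refine Finset.sum_congr rfl fun i _ => ?_
    rw [Finset.mul_sum]
    refine Finset.sum_congr rfl fun j _ => ?_
    simp only [pinnedChain, Pi.smul_apply, Prod.smul_fst, smul_eq_mul]
    split_ifs <;> ring
  unfold OscillatorChain.bmLocalEnergy
  rw [← hI, hsite, hpair]
  ring

/-- **GROWTH SET SCALING.** The set of normalised local energies `{W_{μ,k}/(2k+1)}` (BM (2.5)) of
`s • σ` for the `(lam, β)` chain is the affine image `r ↦ s² r + (1 − s²)` of that of `σ` for the
`(lam s², β s²)` chain. [cite: ButtaMarchioro2016, §2 eq. (2.5)] -/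
theorem bmGrowthSet_smul (s : ℝ) (σ : ChainConfig) :
    (pinnedChain ω₂ lam β γ).bmGrowthSet (s • σ) =
      (fun r => s ^ 2 * r + (1 - s ^ 2)) ''
        (pinnedChain ω₂ (lam * s ^ 2) (β * s ^ 2) γ).bmGrowthSet σ := by
  ext r
  simp only [OscillatorChain.bmGrowthSet, Set.mem_setOf_eq, Set.mem_image]
  constructor
  · rintro ⟨μ, k, hk, rfl⟩
    refine ⟨(pinnedChain ω₂ (lam * s ^ 2) (β * s ^ 2) γ).bmLocalEnergy μ k σ / (2 * (k : ℝ) + 1),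
      ⟨μ, k, hk, rfl⟩, ?_⟩
    rw [bmLocalEnergy_smul, card_Icc_box]
    have hk0 : (2 * (k : ℝ) + 1) ≠ 0 := by positivity
    field_simp
  · rintro ⟨r', ⟨μ, k, hk, rfl⟩, rfl⟩
    refine ⟨μ, k, hk, ?_⟩
    rw [bmLocalEnergy_smul, card_Icc_box]
    have hk0 : (2 * (k : ℝ) + 1) ≠ 0 := by positivity
    field_simp

/-- **THE BM GOOD SET IS DILATION-COVARIANT** (`s ≠ 0`): `s • σ ∈ bmGood^{lam,β}` iff
`σ ∈ bmGood^{lam s²,β s²}` — boundedness above of the normalised local energies is preserved by the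
positive affine map of `bmGrowthSet_smul`. [cite: ButtaMarchioro2016, §2 after eq. (2.5)] -/
theorem smul_mem_bmGood_iff {s : ℝ} (hs : s ≠ 0) (σ : ChainConfig) :
    s • σ ∈ (pinnedChain ω₂ lam β γ).bmGood ↔
      σ ∈ (pinnedChain ω₂ (lam * s ^ 2) (β * s ^ 2) γ).bmGood := by
  simp only [OscillatorChain.bmGood, Set.mem_setOf_eq, bmGrowthSet_smul]
  have hs2 : 0 < s ^ 2 := by positivity
  constructor
  · rintro ⟨B, hB⟩
    refine ⟨(B - (1 - s ^ 2)) / s ^ 2, fun r hr => ?_⟩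
    have h := hB ⟨r, hr, rfl⟩
    rw [le_div_iff₀ hs2]
    linarith
  · rintro ⟨B, hB⟩
    refine ⟨s ^ 2 * B + (1 - s ^ 2), ?_⟩
    rintro _ ⟨r, hr, rfl⟩
    have h := hB hr
    have : s ^ 2 * r ≤ s ^ 2 * B := mul_le_mul_of_nonneg_left h hs2.le
    linarith

/-- The dilation maps the good set of the rescaled chain ONTO the good set:
`S_s(bmGood^{lam s²,β s²}) = bmGood^{lam,β}`. [cite: ButtaMarchioro2016, §2 after eq. (2.5)] -/
theorem image_smul_bmGood {s : ℝ} (hs : s ≠ 0) :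
    (fun σ : ChainConfig => s • σ) '' (pinnedChain ω₂ (lam * s ^ 2) (β * s ^ 2) γ).bmGood =
      (pinnedChain ω₂ lam β γ).bmGood := by
  ext σ
  constructor
  · rintro ⟨τ, hτ, rfl⟩
    exact (smul_mem_bmGood_iff ω₂ lam β γ hs τ).2 hτ
  · intro hσ
    refine ⟨s⁻¹ • σ, (smul_mem_bmGood_iff ω₂ lam β γ hs _).1 ?_, smul_inv_smul₀ hs σ⟩
    rwa [smul_inv_smul₀ hs]

/-- The conjugated dynamics `smulDynamics` has carrier `bmGood` iff the original one has (the BM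
CLASS is dilation-covariant). [cite: ButtaMarchioro2016, §2 after eq. (2.5)] -/
theorem smulDynamics_carrier_eq_bmGood_iff {s : ℝ} (hs : s ≠ 0)
    (D : InfiniteChainDynamics (pinnedChain ω₂ (lam * s ^ 2) (β * s ^ 2) γ)) :
    (smulDynamics ω₂ lam β γ hs D).carrier = (pinnedChain ω₂ lam β γ).bmGood ↔
      D.carrier = (pinnedChain ω₂ (lam * s ^ 2) (β * s ^ 2) γ).bmGood := by
  rw [smulDynamics_carrier, ← image_smul_bmGood ω₂ lam β γ hs]
  exact (Set.image_injective.mpr (smul_right_injective ChainConfig hs)).eq_iff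

/-! ## §2 Shift invariance under the dilation -/

/-- The unit shift is measurable on `ℤ → ℝ × ℝ`. [folklore] -/
theorem measurable_shift :
    Measurable (fun σ : ChainConfig => fun i : ℤ => σ (i + 1)) :=
  measurable_pi_lambda _ fun i => measurable_pi_apply (i + 1)

/-- **SHIFT INVARIANCE TRANSPORTS**: if the unit shift preserves `μ`, it preserves `μ ∘ S_s⁻¹`
(the dilation commutes with the shift). [folklore] -/
theorem measurePreserving_shift_map_dil {s : ℝ} (hs : s ≠ 0) {μ : Measure ChainConfig}
    (h : MeasurePreserving (fun σ : ChainConfig => fun i : ℤ => σ (i + 1)) μ μ) :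
    MeasurePreserving (fun σ : ChainConfig => fun i : ℤ => σ (i + 1))
      (μ.map (dilEquiv hs)) (μ.map (dilEquiv hs)) := by
  have h1 : MeasurePreserving (dilEquiv hs) μ (μ.map (dilEquiv hs)) :=
    ⟨(dilEquiv hs).measurable, rfl⟩
  have h2 := h1.comp (h.comp (MeasurableEquiv.measurePreserving_symm μ (dilEquiv hs)))
  convert h2 using 1
  funext σ
  funext i
  simp only [Function.comp_apply, dilEquiv_apply, dilEquiv_symm_apply, Pi.smul_apply,
    smul_inv_smul₀ hs]

/-! ## §3 Transport of Buttà–Marchioro-class witnesses -/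

/-- **BM-CLASS WITNESSES TRANSPORT** (general `s ≠ 0`, arbitrary clause on `C`). If the rescaled
chain `pinnedChain ω₂ (lam s²) (β s²) γ` has, at temperature `T`, a pair `(μ, D)` — DLR, shift-invariant,
`D.carrier = bmGood`, `μ`-preserving — whose summed current autocorrelation `C'` satisfies `Φ`, and
`Φ C' → Ψ (s⁴ C')`, then `pinnedChain ω₂ lam β γ` has such a pair at temperature `s² T` whose `C`
satisfies `Ψ` (witness: push-forward state and conjugated dynamics; `C = s⁴ C'`).
[cite: AokiLukkarinenSpohn2006, §2 eqs. (2.8)-(2.13)] -/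
theorem bmWitness_transport {s : ℝ} (hs : s ≠ 0) {T : ℝ} {Φ Ψ : (ℝ → ℝ) → Prop}
    (hΦ : ∀ C : ℝ → ℝ, Φ C → Ψ (fun t => s ^ 4 * C t))
    (h : ∃ (μ : Measure ChainConfig)
      (D : InfiniteChainDynamics (pinnedChain ω₂ (lam * s ^ 2) (β * s ^ 2) γ)),
      (pinnedChain ω₂ (lam * s ^ 2) (β * s ^ 2) γ).IsChainGibbsMeasure T μ ∧
      MeasurePreserving (fun σ : ChainConfig => fun i : ℤ => σ (i + 1)) μ μ ∧
      D.carrier = (pinnedChain ω₂ (lam * s ^ 2) (β * s ^ 2) γ).bmGood ∧ D.PreservesMeasure μ ∧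
      Φ (D.currentCorrelation μ)) :
    ∃ (μ : Measure ChainConfig) (D : InfiniteChainDynamics (pinnedChain ω₂ lam β γ)),
      (pinnedChain ω₂ lam β γ).IsChainGibbsMeasure (s ^ 2 * T) μ ∧
      MeasurePreserving (fun σ : ChainConfig => fun i : ℤ => σ (i + 1)) μ μ ∧
      D.carrier = (pinnedChain ω₂ lam β γ).bmGood ∧ D.PreservesMeasure μ ∧
      Ψ (D.currentCorrelation μ) := by
  obtain ⟨μ, D, hG, hS, hcar, hP, hC⟩ := h
  refine ⟨μ.map (dilEquiv hs), smulDynamics ω₂ lam β γ hs D,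
    isChainGibbsMeasure_map_dil ω₂ lam β γ hs hG, measurePreserving_shift_map_dil hs hS,
    (smulDynamics_carrier_eq_bmGood_iff ω₂ lam β γ hs D).2 hcar,
    preservesMeasure_smulDynamics ω₂ lam β γ hs hP, ?_⟩
  have hfun : (smulDynamics ω₂ lam β γ hs D).currentCorrelation (μ.map (dilEquiv hs)) =
      fun t => s ^ 4 * D.currentCorrelation μ t :=
    funext fun t => currentCorrelation_smulDynamics ω₂ lam β γ hs D μ t
  rw [hfun]
  exact hΦ _ hC

/-! ## §4 Low temperature is weak anharmonicity for the two kinetic children -/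

/-- `(√T)⁻¹` rescalings used in both directions. [folklore] -/
theorem sqrt_inv_identities {T : ℝ} (hT : 0 < T) :
    lam * T * (Real.sqrt T)⁻¹ ^ 2 = lam ∧ β * T * (Real.sqrt T)⁻¹ ^ 2 = β ∧
      (Real.sqrt T)⁻¹ ^ 2 * T = 1 ∧ (Real.sqrt T)⁻¹ ^ 4 = (T ^ 2)⁻¹ ∧ Real.sqrt T ^ 4 = T ^ 2 := by
  have hs : Real.sqrt T ≠ 0 := (Real.sqrt_pos.mpr hT).ne'
  have hs2 : Real.sqrt T ^ 2 = T := Real.sq_sqrt hT.le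
  have hs4 : Real.sqrt T ^ 4 = T ^ 2 := by
    calc Real.sqrt T ^ 4 = (Real.sqrt T ^ 2) ^ 2 := by ring
      _ = T ^ 2 := by rw [hs2]
  refine ⟨?_, ?_, ?_, ?_, hs4⟩
  · rw [inv_pow, hs2]; field_simp
  · rw [inv_pow, hs2]; field_simp
  · rw [inv_pow, hs2]; field_simp
  · rw [inv_pow, hs4]

/-- **TAIL WITNESSES: `(lam, β; T)` ⇔ `(lam T, β T; 1)`** (pointwise form of child 1's clause, any
threshold `t₀` and bound `e`): a BM-class pair of `pinnedChain ω₂ lam β γ` at temperature `T > 0` with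
`C ∈ L¹(t₀, ∞)`, `∫_{t₀}^∞ |C| ≤ e` exists iff a BM-class pair of the unit-temperature chain
`pinnedChain ω₂ (lam T) (β T) γ` with `C₁ ∈ L¹(t₀, ∞)`, `T² ∫_{t₀}^∞ |C₁| ≤ e` exists (`C = T² C₁`).
[cite: AokiLukkarinenSpohn2006, §2 eq. (2.13)] -/
theorem exists_bmTailWitness_iff_unit_temp {T : ℝ} (hT : 0 < T) (t₀ e : ℝ) :
    (∃ (μ : Measure ChainConfig) (D : InfiniteChainDynamics (pinnedChain ω₂ lam β γ)),
      (pinnedChain ω₂ lam β γ).IsChainGibbsMeasure T μ ∧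
      MeasurePreserving (fun σ : ChainConfig => fun i : ℤ => σ (i + 1)) μ μ ∧
      D.carrier = (pinnedChain ω₂ lam β γ).bmGood ∧ D.PreservesMeasure μ ∧
      (IntegrableOn (D.currentCorrelation μ) (Ioi t₀) ∧
        ∫ t in Ioi t₀, |D.currentCorrelation μ t| ≤ e)) ↔
    (∃ (μ : Measure ChainConfig) (D : InfiniteChainDynamics (pinnedChain ω₂ (lam * T) (β * T) γ)),
      (pinnedChain ω₂ (lam * T) (β * T) γ).IsChainGibbsMeasure 1 μ ∧
      MeasurePreserving (fun σ : ChainConfig => fun i : ℤ => σ (i + 1)) μ μ ∧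
      D.carrier = (pinnedChain ω₂ (lam * T) (β * T) γ).bmGood ∧ D.PreservesMeasure μ ∧
      (IntegrableOn (D.currentCorrelation μ) (Ioi t₀) ∧
        T ^ 2 * ∫ t in Ioi t₀, |D.currentCorrelation μ t| ≤ e)) := by
  have hs : Real.sqrt T ≠ 0 := (Real.sqrt_pos.mpr hT).ne'
  obtain ⟨e1, e2, e3, e4, e5⟩ := sqrt_inv_identities lam β hT
  have hT2 : 0 < T ^ 2 := by positivity
  -- the scaling of the two analytic clauses
  have hscale : ∀ (s : ℝ) (C : ℝ → ℝ), IntegrableOn C (Ioi t₀) →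
      IntegrableOn (fun t => s ^ 4 * C t) (Ioi t₀) ∧
        ∫ t in Ioi t₀, |s ^ 4 * C t| = s ^ 4 * ∫ t in Ioi t₀, |C t| := by
    intro s C hC
    refine ⟨hC.const_mul (s ^ 4), ?_⟩
    have : (fun t => |s ^ 4 * C t|) = fun t => s ^ 4 * |C t| := by
      funext t
      rw [abs_mul, abs_of_nonneg (by positivity : (0 : ℝ) ≤ s ^ 4)]
    rw [this, integral_const_mul]
  constructor
  · intro h
    -- go DOWN with `s = (√T)⁻¹`: `(lam, β; T) = ((lam T) s², (β T) s²; T)` ↦ `(lam T, β T; s² T = 1)`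
    have key := bmWitness_transport ω₂ (lam * T) (β * T) γ (inv_ne_zero hs) (T := T)
      (Φ := fun C => IntegrableOn C (Ioi t₀) ∧ ∫ t in Ioi t₀, |C t| ≤ e)
      (Ψ := fun C => IntegrableOn C (Ioi t₀) ∧ T ^ 2 * ∫ t in Ioi t₀, |C t| ≤ e) ?_
    · rw [e1, e2, e3] at key
      exact key h
    · rintro C ⟨hC, hCe⟩
      obtain ⟨hint, hval⟩ := hscale (Real.sqrt T)⁻¹ C hC
      refine ⟨hint, ?_⟩
      rw [hval, e4, ← mul_assoc, mul_inv_cancel₀ hT2.ne', one_mul]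
      exact hCe
  · intro h
    -- go UP with `s = √T`
    have key := bmWitness_transport ω₂ lam β γ hs (T := 1)
      (Φ := fun C => IntegrableOn C (Ioi t₀) ∧ T ^ 2 * ∫ t in Ioi t₀, |C t| ≤ e)
      (Ψ := fun C => IntegrableOn C (Ioi t₀) ∧ ∫ t in Ioi t₀, |C t| ≤ e) ?_
    · rw [Real.sq_sqrt hT.le, mul_one] at key
      exact key h
    · rintro C ⟨hC, hCe⟩
      obtain ⟨hint, hval⟩ := hscale (Real.sqrt T) C hC
      refine ⟨hint, ?_⟩
      rw [hval, e5]
      exact hCe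

/-- **CHILD 1 (`BmPostKineticTail`) AT `(ω₂, lam, β, γ)` ⇔ ITS WEAK-ANHARMONICITY FORM.** The
post-kinetic tail statement in existential Buttà–Marchioro form (the registered stub
`LineSketch.stub_bmPostKineticTail` with the four parameters fixed; child 1 of `SPLIT-READY.md`)
is EXACTLY: for every `e > 0` there are `M, ε₀ > 0` such that for all `ε ∈ (0, ε₀)` the
UNIT-TEMPERATURE chain `pinnedChain ω₂ (lam ε) (β ε) γ` has a BM-class pair whose summed current
autocorrelation is integrable on `(M ε⁻², ∞)` with `ε² ∫_{M ε⁻²}^∞ |C| ≤ e` — the tail beyond every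
kinetic multiple `M ε⁻²`, in the kinetic amplitude normalisation `ε²`, small uniformly in the
anharmonicity `ε`. [cite: AokiLukkarinenSpohn2006, §2 eq. (2.13)] -/
theorem bmPostKineticTail_iff_unit_temp' :
    (∀ e : ℝ, 0 < e → ∃ M T₀ : ℝ, 0 < M ∧ 0 < T₀ ∧ ∀ T : ℝ, 0 < T → T < T₀ →
      ∃ (μ : Measure ChainConfig) (D : InfiniteChainDynamics (pinnedChain ω₂ lam β γ)),
        (pinnedChain ω₂ lam β γ).IsChainGibbsMeasure T μ ∧
        MeasurePreserving (fun σ : ChainConfig => fun i : ℤ => σ (i + 1)) μ μ ∧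
        D.carrier = (pinnedChain ω₂ lam β γ).bmGood ∧ D.PreservesMeasure μ ∧
        IntegrableOn (D.currentCorrelation μ) (Ioi (M / T ^ 2)) ∧
        ∫ t in Ioi (M / T ^ 2), |D.currentCorrelation μ t| ≤ e) ↔
    (∀ e : ℝ, 0 < e → ∃ M ε₀ : ℝ, 0 < M ∧ 0 < ε₀ ∧ ∀ ε : ℝ, 0 < ε → ε < ε₀ →
      ∃ (μ : Measure ChainConfig) (D : InfiniteChainDynamics (pinnedChain ω₂ (lam * ε) (β * ε) γ)),
        (pinnedChain ω₂ (lam * ε) (β * ε) γ).IsChainGibbsMeasure 1 μ ∧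
        MeasurePreserving (fun σ : ChainConfig => fun i : ℤ => σ (i + 1)) μ μ ∧
        D.carrier = (pinnedChain ω₂ (lam * ε) (β * ε) γ).bmGood ∧ D.PreservesMeasure μ ∧
        IntegrableOn (D.currentCorrelation μ) (Ioi (M / ε ^ 2)) ∧
        ε ^ 2 * ∫ t in Ioi (M / ε ^ 2), |D.currentCorrelation μ t| ≤ e) := by
  refine forall_congr' fun e => forall_congr' fun _ => exists_congr fun M =>
    exists_congr fun T₀ => and_congr_right fun _ => and_congr_right fun _ =>
    forall_congr' fun T => forall_congr' fun hT => forall_congr' fun _ => ?_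
  exact exists_bmTailWitness_iff_unit_temp ω₂ lam β γ hT (M / T ^ 2) e

/-- **CHILD 1 ⇔ ITS WEAK-ANHARMONICITY FORM — registered sub-goal form** (all four parameters bound;
fully qualified names; this is the signature registered on stmt-AtomisticToContinuum-12593 as
`bmPostKineticTail_iff_unit_temp`). [cite: AokiLukkarinenSpohn2006, §2 eq. (2.13)] -/
theorem bmPostKineticTail_iff_unit_temp : ∀ ω₂ lam β γ : ℝ, ((∀ e : ℝ, 0 < e → ∃ M T₀ : ℝ, 0 < M ∧ 0 < T₀ ∧ ∀ T : ℝ, 0 < T → T < T₀ → ∃ (μ : MeasureTheory.Measure Literature.MathematicalPhysics.KineticTheory.HeatConduction.ChainConfig) (D : Literature.MathematicalPhysics.KineticTheory.HeatConduction.InfiniteChainDynamics (Literature.MathematicalPhysics.KineticTheory.HeatConduction.pinnedChain ω₂ lam β γ)), (Literature.MathematicalPhysics.KineticTheory.HeatConduction.pinnedChain ω₂ lam β γ).IsChainGibbsMeasure T μ ∧ MeasureTheory.MeasurePreserving (fun σ : Literature.MathematicalPhysics.KineticTheory.HeatConduction.ChainConfig => fun i : ℤ => σ (i + 1)) μ μ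 ∧ D.carrier = (Literature.MathematicalPhysics.KineticTheory.HeatConduction.pinnedChain ω₂ lam β γ).bmGood ∧ D.PreservesMeasure μ ∧ MeasureTheory.IntegrableOn (D.currentCorrelation μ) (Set.Ioi (M / T ^ 2)) ∧ ∫ t in Set.Ioi (M / T ^ 2), |D.currentCorrelation μ t| ≤ e) ↔ (∀ e : ℝ, 0 < e → ∃ M ε₀ : ℝ, 0 < M ∧ 0 < ε₀ ∧ ∀ ε : ℝ, 0 < ε → ε < ε₀ → ∃ (μ : MeasureTheory.Measure Literature.MathematicalPhysics.KineticTheory.HeatConduction.ChainConfig) (D : Literature.MathematicalPhysics.KineticTheory.HeatConduction.InfiniteChainDynamics (Literature.MathematicalPhysics.KineticTheory.HeatConduction.pinnedChain ω₂ (lam * ε) (β * ε) γ)), (Literature.MathematicalPhysics.KineticTheory.HeatConduction.pinnedChain ω₂ (lam * ε) (β * ε) γ).IsChainGibbsMeasure 1 μ ∧ MeasureTheory.MeasurePreserving (fun σ : Literature.MathematicalPhysics.KineticTheory.HeatConduction.ChainConfig => fun i : ℤ => σ (i + 1)) μ μ ∧ D.carrier = (Literature.MathematicalPhysics.KineticTheory.HeatConduction.pinnedChain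 ω₂ (lam * ε) (β * ε) γ).bmGood ∧ D.PreservesMeasure μ ∧ MeasureTheory.IntegrableOn (D.currentCorrelation μ) (Set.Ioi (M / ε ^ 2)) ∧ ε ^ 2 * ∫ t in Set.Ioi (M / ε ^ 2), |D.currentCorrelation μ t| ≤ e)) :=
  fun ω₂ lam β γ => bmPostKineticTail_iff_unit_temp' ω₂ lam β γ

/-- **WINDOW WITNESSES: `(lam, β; T)` ⇔ `(lam T, β T; 1)`** (pointwise form of child 2's clause, any
window `[a, b]`, target value `c` and tolerance `e`): a BM-class pair at `T > 0` with
`|∫_a^b C − c| ≤ e` exists iff a unit-temperature BM-class pair of `pinnedChain ω₂ (lam T) (β T) γ`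
with `|T² ∫_a^b C₁ − c| ≤ e` exists. [cite: AokiLukkarinenSpohn2006, §2 eq. (2.13)] -/
theorem exists_bmWindowWitness_iff_unit_temp {T : ℝ} (hT : 0 < T) (a b c e : ℝ) :
    (∃ (μ : Measure ChainConfig) (D : InfiniteChainDynamics (pinnedChain ω₂ lam β γ)),
      (pinnedChain ω₂ lam β γ).IsChainGibbsMeasure T μ ∧
      MeasurePreserving (fun σ : ChainConfig => fun i : ℤ => σ (i + 1)) μ μ ∧
      D.carrier = (pinnedChain ω₂ lam β γ).bmGood ∧ D.PreservesMeasure μ ∧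
      |(∫ t in a..b, D.currentCorrelation μ t) - c| ≤ e) ↔
    (∃ (μ : Measure ChainConfig) (D : InfiniteChainDynamics (pinnedChain ω₂ (lam * T) (β * T) γ)),
      (pinnedChain ω₂ (lam * T) (β * T) γ).IsChainGibbsMeasure 1 μ ∧
      MeasurePreserving (fun σ : ChainConfig => fun i : ℤ => σ (i + 1)) μ μ ∧
      D.carrier = (pinnedChain ω₂ (lam * T) (β * T) γ).bmGood ∧ D.PreservesMeasure μ ∧
      |T ^ 2 * (∫ t in a..b, D.currentCorrelation μ t) - c| ≤ e) := by
  have hs : Real.sqrt T ≠ 0 := (Real.sqrt_pos.mpr hT).ne'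
  obtain ⟨e1, e2, e3, e4, e5⟩ := sqrt_inv_identities lam β hT
  have hT2 : 0 < T ^ 2 := by positivity
  constructor
  · intro h
    have key := bmWitness_transport ω₂ (lam * T) (β * T) γ (inv_ne_zero hs) (T := T)
      (Φ := fun C => |(∫ t in a..b, C t) - c| ≤ e)
      (Ψ := fun C => |T ^ 2 * (∫ t in a..b, C t) - c| ≤ e) ?_
    · rw [e1, e2, e3] at key
      exact key h
    · intro C hC
      rw [intervalIntegral.integral_const_mul, e4, ← mul_assoc, mul_inv_cancel₀ hT2.ne', one_mul]
      exact hC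
  · intro h
    have key := bmWitness_transport ω₂ lam β γ hs (T := 1)
      (Φ := fun C => |T ^ 2 * (∫ t in a..b, C t) - c| ≤ e)
      (Ψ := fun C => |(∫ t in a..b, C t) - c| ≤ e) ?_
    · rw [Real.sq_sqrt hT.le, mul_one] at key
      exact key h
    · intro C hC
      rw [intervalIntegral.integral_const_mul, e5]
      exact hC

/-- **CHILD 2 (`BmKineticLimit`) AT `(ω₂, lam, β, γ)` ⇔ ITS WEAK-ANHARMONICITY FORM.** The
wave-kinetic-window statement in existential Buttà–Marchioro form (the registered stub
`LineSketch.stub_bmKineticLimit` with the four parameters fixed; child 2 of `SPLIT-READY.md`) is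
EXACTLY: there is `K ∈ L¹(0, ∞)` with `∫₀^∞ K > 0` such that for all `0 < δ ≤ M`, `e > 0` there is
`ε₀ > 0` with, for every `ε ∈ (0, ε₀)`, a BM-class pair of the UNIT-TEMPERATURE chain
`pinnedChain ω₂ (lam ε) (β ε) γ` having `|ε² ∫_{δ ε⁻²}^{M ε⁻²} C − ∫_δ^M K| ≤ e` (kinetic clock `ε⁻²`,
amplitude `ε²`; the same kernel `K`). [cite: AokiLukkarinenSpohn2006, §2 eq. (2.13) and §3 (3.20)-(3.23)] -/
theorem bmKineticLimit_iff_unit_temp :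
    (∃ K : ℝ → ℝ, IntegrableOn K (Ioi 0) ∧ 0 < ∫ τ in Ioi 0, K τ ∧
      ∀ δ M e : ℝ, 0 < δ → δ ≤ M → 0 < e → ∃ T₀ : ℝ, 0 < T₀ ∧ ∀ T : ℝ, 0 < T → T < T₀ →
        ∃ (μ : Measure ChainConfig) (D : InfiniteChainDynamics (pinnedChain ω₂ lam β γ)),
          (pinnedChain ω₂ lam β γ).IsChainGibbsMeasure T μ ∧
          MeasurePreserving (fun σ : ChainConfig => fun i : ℤ => σ (i + 1)) μ μ ∧
          D.carrier = (pinnedChain ω₂ lam β γ).bmGood ∧ D.PreservesMeasure μ ∧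
          |(∫ t in (δ / T ^ 2)..(M / T ^ 2), D.currentCorrelation μ t) - ∫ τ in δ..M, K τ| ≤ e) ↔
    (∃ K : ℝ → ℝ, IntegrableOn K (Ioi 0) ∧ 0 < ∫ τ in Ioi 0, K τ ∧
      ∀ δ M e : ℝ, 0 < δ → δ ≤ M → 0 < e → ∃ ε₀ : ℝ, 0 < ε₀ ∧ ∀ ε : ℝ, 0 < ε → ε < ε₀ →
        ∃ (μ : Measure ChainConfig) (D : InfiniteChainDynamics (pinnedChain ω₂ (lam * ε) (β * ε) γ)),
          (pinnedChain ω₂ (lam * ε) (β * ε) γ).IsChainGibbsMeasure 1 μ ∧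
          MeasurePreserving (fun σ : ChainConfig => fun i : ℤ => σ (i + 1)) μ μ ∧
          D.carrier = (pinnedChain ω₂ (lam * ε) (β * ε) γ).bmGood ∧ D.PreservesMeasure μ ∧
          |ε ^ 2 * (∫ t in (δ / ε ^ 2)..(M / ε ^ 2), D.currentCorrelation μ t) -
              ∫ τ in δ..M, K τ| ≤ e) := by
  refine exists_congr fun K => and_congr_right fun _ => and_congr_right fun _ =>
    forall₃_congr fun δ M e => forall_congr' fun _ => forall_congr' fun _ => forall_congr' fun _ =>
    exists_congr fun T₀ => and_congr_right fun _ =>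
    forall_congr' fun T => forall_congr' fun hT => forall_congr' fun _ => ?_
  exact exists_bmWindowWitness_iff_unit_temp ω₂ lam β γ hT (δ / T ^ 2) (M / T ^ 2)
    (∫ τ in δ..M, K τ) e

end Summit.AtomisticToContinuum.FouriersLaw.Theorems.DrudeDissolution.ChildrenScaling

end
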